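import Literature.Probability.LatticeModels.GridDomainConformalGeometry
import Literature.Probability.LatticeModels.GridDomainGreenTruncation
import Literature.Probability.LatticeModels.LatticeWalkWinding
import Literature.Topology.PlaneTopology.WindowCrossing
import HarnessLib

/-!
# Screening by a lattice path running near the boundary of a grid domain (towards LSW 2004,
# Prop. 2.2): walks confined to a conformal window above the path cannot be killed, and are finite
# in number

Topic `Literature/Probability/LatticeModels`; continuation of `GridDomainConformalGeometry.lean` and
`Literature/Topology/PlaneTopology/WindowCrossing.lean`. In the proof of G. F. Lawler, O. Schramm,
W. Werner, *Conformal invariance of planar loop-erased random walks and uniform spanning trees*,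
Ann. Probab. 32 (2004), Prop. 2.2 (§5.2), a lattice path `J` on which the discrete harmonic
function `h` is large joins a point conformally far from the boundary point `c = ψ(u)` to the dart
`u`; when its image under the disc map `ψ` hugs the unit circle across an angular window about
`c`, the walk started at a lattice point `x⁺` conformally "above" `J` in the window cannot reach
the boundary of `D` inside the window without passing through a vertex of `J` (planar topology:
`window_crossing`), so that the hitting probability of `J` from `x⁺` is bounded below by the
boundary-hitting lemma. This file proves the two combinatorial consequences used there, for the set
`U` of lattice points reachable from `x⁺` through sites of a set `S` (the sites conformally near
`x⁺`, minus the vertices of `J`):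

* `LSWGrid.screening_core` — the abstract contradiction: a lattice walk `P` from `x⁺` through
  `S` followed by a preconnected tail `T ⊆ D` whose `ψ`-image accumulates at the circle, all inside
  the window, while the polygon of `J` crosses the window below the level of `x⁺`, is impossible
  (the polygon of `J` and the polygon of `P` would share a point, hence — two lattice edges that
  meet share an endpoint — a vertex);
* `LSWGrid.false_of_walk_of_dart` — with `T` the exit edge `[u, b)` of a dart at the end of `P`
  (the disc map is proper along it): **no site of `U` is adjacent to a point outside `V(D)`**;
* `LSWGrid.norm_lt_of_walk` — with `T = ψ⁻¹(ψ(u) + [0, t*) c)`, the segment from `ψ(u)` in the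
  direction `c` up to the circle (constant tangential coordinate): every site of `U` has
  `‖ψ‖` at most the maximal modulus on the polygon of `J`, so that **`U` is finite**;
* `LSWGrid.screened_component` — the packaged statement about
  `U = {u | (siteGraph S).Reachable x⁺ u}`: `U ⊆ S`, `U` finite, every lattice neighbour of a site
  of `U` lies in `V(D)`, and a neighbour outside `U` lies outside `S`.

The hypotheses are pointwise conformal conditions ("window conditions") on the points of `D`
conformally within the mesh bound `1500/√(log(inrad/3))` of `S`, resp. of the vertices of `J`; the
application (`GridDomainCarlesonBound.lean`) derives them from the position of `x⁺` and of `J`.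
Everything is proved; no definition and no named fact is introduced.

## References

* G. F. Lawler, O. Schramm, W. Werner, Ann. Probab. 32 (2004) 939–995, §5.2 [LawlerSchrammWerner2004].
-/

noncomputable section

open Set Metric Filter
open scoped Topology

namespace Literature.Probability.LatticeModels

namespace LSWGrid

open Complex Literature.Topology.PlaneTopology
open Literature.Probability.RandomPlanarGeometry (ChordalLERW.siteGraph ChordalLERW.siteGraph_adj_iff
  ChordalLERW.siteGraph_le_zdGraph)

variable {D : Set ℂ} {ψ : ℂ → ℂ}

/-! ### Polygons of lattice walks in a grid domain -/

/-- The polygon of a lattice walk through lattice points of a grid domain lies in the domain.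
[folklore] -/
theorem range_walkPath_subset (hD : IsGridDomain D) {a b : Site 2} (p : (zdGraph 2).Walk a b)
    (hp : ∀ v ∈ p.support, v ∈ latticeVertices D) : range (walkPath p) ⊆ D :=
  range_walkPath_subset_of_ball_subset p fun v hv => hD.ball_one_subset (hp v hv)

/-- **Points of the polygon are conformally close to a vertex**: for `D ∈ 𝔇` with `inrad(D) ≥ 8`,
every point of the polygon of a lattice walk through `V(D)` has `ψ`-image within
`1500/√(log(inrad(D)/3))` of the image of a vertex. [cite: LawlerSchrammWerner2004, §5.2] -/
theorem exists_vertex_norm_sub_le (hD : IsClassD D) (hψ : IsDiscMap D ψ)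
    (hR : 8 ≤ infDist (0 : ℂ) Dᶜ) {a b : Site 2} (p : (zdGraph 2).Walk a b)
    (hp : ∀ v ∈ p.support, v ∈ latticeVertices D) {z : ℂ} (hz : z ∈ range (walkPath p)) :
    ∃ x ∈ p.support, ‖ψ z - ψ (Site.toComplex x)‖ ≤
      1500 / Real.sqrt (Real.log (infDist (0 : ℂ) Dᶜ / 3)) := by
  obtain ⟨x, hx, y, hy, hxy, hzseg⟩ := exists_mem_segment_of_mem_range_walkPath p hz
  refine ⟨x, hx, ?_⟩
  rcases hxy with rfl | hxy
  · rw [segment_same, mem_singleton_iff] at hzseg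
    rw [hzseg, sub_self, norm_zero]
    positivity
  · set X := Site.toComplex x with hX
    set Y := Site.toComplex y with hY
    set c : ℂ := X + (1 / 2 : ℝ) • (Y - X) with hc
    have hXY : ‖Y - X‖ = 1 := norm_toComplex_sub_of_adj hxy
    have hQp : segment ℝ X Y ⊆ ball c 1 := by
      rw [segment_eq_image']
      rintro _ ⟨t, ⟨ht0, ht1⟩, rfl⟩
      rw [mem_ball, dist_eq_norm]
      have : X + t • (Y - X) - c = (t - 1 / 2 : ℝ) • (Y - X) := by
        rw [hc, sub_smul]; abel
      rw [this, norm_smul, hXY, mul_one, Real.norm_eq_abs, abs_lt]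
      constructor <;> linarith
    exact norm_sub_le_of_isPreconnected hD hψ hR (convex_segment X Y).isPreconnected
      (segment_subset hD.1 (hp x hx) (hp y hy) hxy) hQp hzseg (left_mem_segment ℝ X Y)

/-- Two lattice polygons through disjoint vertex sets do not meet. [folklore] -/
theorem disjoint_range_walkPath {a b a' b' : Site 2} (P : (zdGraph 2).Walk a b)
    (W : (zdGraph 2).Walk a' b') (hPW : ∀ y ∈ P.support, y ∉ W.support) :
    Disjoint (range (walkPath P)) (range (walkPath W)) := by
  rw [Set.disjoint_left]
  intro w hwP hwW
  obtain ⟨x₁, hx₁, y₁, hy₁, hxy₁, hw₁⟩ := exists_mem_segment_of_mem_range_walkPath P hwP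
  obtain ⟨x₂, hx₂, y₂, hy₂, hxy₂, hw₂⟩ := exists_mem_segment_of_mem_range_walkPath W hwW
  rcases hxy₁ with rfl | hadj₁
  · rw [segment_same, mem_singleton_iff] at hw₁
    rw [hw₁] at hw₂
    rcases eq_or_eq_of_toComplex_mem_segment hxy₂ hw₂ with rfl | rfl
    · exact hPW _ hx₁ hx₂
    · exact hPW _ hx₁ hy₂
  · rcases hxy₂ with rfl | hadj₂
    · rw [segment_same, mem_singleton_iff] at hw₂
      rw [hw₂] at hw₁
      rcases eq_or_eq_of_toComplex_mem_segment (Or.inr hadj₁) hw₁ with rfl | rfl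
      · exact hPW _ hx₁ hx₂
      · exact hPW _ hy₁ hx₂
    · obtain ⟨z, hz₁, hz₂⟩ := exists_common_endpoint hadj₁ hadj₂ ⟨w, hw₁, hw₂⟩
      have hzP : z ∈ P.support := by rcases hz₁ with rfl | rfl <;> assumption
      have hzW : z ∈ W.support := by rcases hz₂ with rfl | rfl <;> assumption
      exact hPW z hzP hzW

/-! ### The abstract screening contradiction -/

/-- **Screening (abstract form).** Let `D ∈ 𝔇`, `ψ` a disc map, `|c| = 1`, a window
`{a ≤ im(ζ c̄) ≤ b, lo ≤ |ζ| ≤ 1}` (`a ≤ b`, `lo ≤ 1`) and levels `r₀ > 0`, `m`. Let `W` be a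
lattice walk through `V(D)` (the screen) with a vertex of tangential coordinate `≤ a` and one
`≥ b`, whose polygon has, in conformal coordinates, modulus `≥ lo`, `re(· c̄) ≥ r₀`, and modulus
`> m` inside the tangential range `[a, b]`. Let `P` be a lattice walk through `V(D)` avoiding the
vertices of `W`, from a point `x` with `‖ψ x‖ ≤ m`, followed by a preconnected tail `T ⊆ D` from
its endpoint, such that the polygon of `P` and `T` satisfy the window conditions, the closure of
`ψ(T)` contains a point of the circle, its points inside the disc are points of `ψ(T)`, and `T`
misses the polygon of `W`. This is impossible. [cite: LawlerSchrammWerner2004, §5.2] -/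
theorem screening_core (hD : IsClassD D) (hψ : IsDiscMap D ψ) {c : ℂ} (hc : ‖c‖ = 1)
    {a b lo r₀ m : ℝ} (hab : a ≤ b) (hlo : lo ≤ 1) (hr₀ : 0 < r₀)
    {z₁ q' : Site 2} (W : (zdGraph 2).Walk z₁ q') (hWV : ∀ x ∈ W.support, x ∈ latticeVertices D)
    (hΓa : ∃ x ∈ W.support, (ψ (Site.toComplex x) * (starRingEnd ℂ) c).im ≤ a)
    (hΓb : ∃ x ∈ W.support, b ≤ (ψ (Site.toComplex x) * (starRingEnd ℂ) c).im)
    (hΓwin : ∀ z ∈ range (walkPath W), lo ≤ ‖ψ z‖ ∧ r₀ ≤ (ψ z * (starRingEnd ℂ) c).re ∧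
      (a ≤ (ψ z * (starRingEnd ℂ) c).im → (ψ z * (starRingEnd ℂ) c).im ≤ b → m < ‖ψ z‖))
    {x u : Site 2} (P : (zdGraph 2).Walk x u) (hPV : ∀ y ∈ P.support, y ∈ latticeVertices D)
    (hPW : ∀ y ∈ P.support, y ∉ W.support) (hxm : ‖ψ (Site.toComplex x)‖ ≤ m)
    {T : Set ℂ} (hTD : T ⊆ D) (hTp : IsPreconnected T) (huT : Site.toComplex u ∈ T)
    (hwin : ∀ z ∈ range (walkPath P) ∪ T, a ≤ (ψ z * (starRingEnd ℂ) c).im ∧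
      (ψ z * (starRingEnd ℂ) c).im ≤ b ∧ lo ≤ ‖ψ z‖ ∧ r₀ ≤ (ψ z * (starRingEnd ℂ) c).re)
    (hTtop : ∃ ζ ∈ closure (ψ '' T), ‖ζ‖ = 1)
    (hTclos : closure (ψ '' T) ∩ ball 0 1 ⊆ ψ '' T)
    (hTW : Disjoint T (range (walkPath W))) : False := by
  have hopen : IsOpen D := hD.1.1
  have hc0 : c ≠ 0 := fun h => by rw [h, norm_zero] at hc; exact zero_ne_one hc
  have hψc : ContinuousOn ψ D := hψ.continuousOn
  -- the screen `Γ = ψ(polygon of W)`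
  have hWD : range (walkPath W) ⊆ D := range_walkPath_subset hD.1 W hWV
  set Γ : Set ℂ := ψ '' range (walkPath W) with hΓ
  have hΓc : IsCompact Γ := (isCompact_range (walkPath W).continuous).image_of_continuousOn (hψc.mono hWD)
  have hΓp : IsPreconnected Γ :=
    (isConnected_range (walkPath W).continuous).isPreconnected.image ψ (hψc.mono hWD)
  have hΓ1 : ∀ ζ ∈ Γ, ‖ζ‖ < 1 := by
    rintro _ ⟨z, hz, rfl⟩; exact hψ.norm_lt_one (hWD hz)
  have hΓre : ∀ ζ ∈ Γ, 0 < (ζ * (starRingEnd ℂ) c).re := by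
    rintro _ ⟨z, hz, rfl⟩; exact hr₀.trans_le (hΓwin z hz).2.1
  have hΓa' : ∃ ζ ∈ Γ, (ζ * (starRingEnd ℂ) c).im ≤ a := by
    obtain ⟨x', hx', h⟩ := hΓa
    exact ⟨_, ⟨_, toComplex_mem_range_walkPath W hx', rfl⟩, h⟩
  have hΓb' : ∃ ζ ∈ Γ, b ≤ (ζ * (starRingEnd ℂ) c).im := by
    obtain ⟨x', hx', h⟩ := hΓb
    exact ⟨_, ⟨_, toComplex_mem_range_walkPath W hx', rfl⟩, h⟩
  have hΓlo : ∀ ζ ∈ Γ, lo ≤ ‖ζ‖ := by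
    rintro _ ⟨z, hz, rfl⟩; exact (hΓwin z hz).1
  have hΓm : ∀ ζ ∈ Γ, a ≤ (ζ * (starRingEnd ℂ) c).im → (ζ * (starRingEnd ℂ) c).im ≤ b → m < ‖ζ‖ := by
    rintro _ ⟨z, hz, rfl⟩; exact (hΓwin z hz).2.2
  -- the other continuum `L = ψ(polygon of P ∪ T)`
  have hPD : range (walkPath P) ⊆ D := range_walkPath_subset hD.1 P hPV
  have hPTD : range (walkPath P) ∪ T ⊆ D := union_subset hPD hTD
  set L : Set ℂ := ψ '' (range (walkPath P) ∪ T) with hL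
  have huP : Site.toComplex u ∈ range (walkPath P) := toComplex_mem_range_walkPath P (by simp)
  have hLp : IsPreconnected L :=
    ((isConnected_range (walkPath P).continuous).isPreconnected.union (Site.toComplex u) huP huT
      hTp).image ψ (hψc.mono hPTD)
  have hPimg_c : IsCompact (ψ '' range (walkPath P)) :=
    (isCompact_range (walkPath P).continuous).image_of_continuousOn (hψc.mono hPD)
  have hclosL : closure L ⊆ ψ '' range (walkPath P) ∪ closure (ψ '' T) := by
    rw [hL, image_union, closure_union, hPimg_c.isClosed.closure_eq]
  -- window conditions on the closure of `ψ(T)`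
  set C : Set ℂ := {ζ | a ≤ (ζ * (starRingEnd ℂ) c).im ∧ (ζ * (starRingEnd ℂ) c).im ≤ b ∧
    lo ≤ ‖ζ‖ ∧ ‖ζ‖ ≤ 1 ∧ r₀ ≤ (ζ * (starRingEnd ℂ) c).re} with hC
  have hCclosed : IsClosed C := by
    have h1 : Continuous fun ζ : ℂ => (ζ * (starRingEnd ℂ) c).im := continuous_im.comp (continuous_id.mul continuous_const)
    have h2 : Continuous fun ζ : ℂ => (ζ * (starRingEnd ℂ) c).re := continuous_re.comp (continuous_id.mul continuous_const)
    refine (isClosed_le continuous_const h1).inter ((isClosed_le h1 continuous_const).inter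
      ((isClosed_le continuous_const continuous_norm).inter
        ((isClosed_le continuous_norm continuous_const).inter (isClosed_le continuous_const h2))))
  have hLC : ∀ z ∈ range (walkPath P) ∪ T, ψ z ∈ C := fun z hz =>
    ⟨(hwin z hz).1, (hwin z hz).2.1, (hwin z hz).2.2.1, (hψ.norm_lt_one (hPTD hz)).le, (hwin z hz).2.2.2⟩
  have hTC : closure (ψ '' T) ⊆ C :=
    closure_minimal (by rintro _ ⟨z, hz, rfl⟩; exact hLC z (Or.inr hz)) hCclosed
  have hclosLC : closure L ⊆ C := by
    intro ζ hζ
    rcases hclosL hζ with ⟨z, hz, rfl⟩ | h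
    · exact hLC z (Or.inl hz)
    · exact hTC h
  have hLre : ∀ ζ ∈ closure L, 0 < (ζ * (starRingEnd ℂ) c).re := fun ζ hζ =>
    hr₀.trans_le (hclosLC hζ).2.2.2.2
  have hLwin : ∀ ζ ∈ closure L, a ≤ (ζ * (starRingEnd ℂ) c).im ∧ (ζ * (starRingEnd ℂ) c).im ≤ b ∧
      lo ≤ ‖ζ‖ ∧ ‖ζ‖ ≤ 1 := fun ζ hζ =>
    ⟨(hclosLC hζ).1, (hclosLC hζ).2.1, (hclosLC hζ).2.2.1, (hclosLC hζ).2.2.2.1⟩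
  have hLtop : ∃ ζ ∈ closure L, ‖ζ‖ = 1 := by
    obtain ⟨ζ, hζ, h1⟩ := hTtop
    exact ⟨ζ, closure_mono (image_mono subset_union_right) hζ, h1⟩
  have hζ₀ : ψ (Site.toComplex x) ∈ L :=
    ⟨_, Or.inl (toComplex_mem_range_walkPath P (by simp)), rfl⟩
  -- the crossing point
  obtain ⟨ζ, hζΓ, hζL⟩ := window_crossing hc0 hab hlo hΓc hΓp hΓ1 hΓre hΓa' hΓb' hΓlo hΓm hLp hLre
    hLwin hLtop hζ₀ hxm
  obtain ⟨j, hj, rfl⟩ := hζΓ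
  have hjD : j ∈ D := hWD hj
  rcases hclosL hζL with ⟨w, hw, hwj⟩ | hT
  · -- a common point of the two polygons
    have hwD : w ∈ D := hPD hw
    have heq : w = j := hψ.2.1.injOn hwD hjD hwj
    exact Set.disjoint_left.1 (disjoint_range_walkPath P W hPW) hw (heq ▸ hj)
  · -- a point of the tail on the screen
    have hball : ψ j ∈ ball (0 : ℂ) 1 := mem_ball_zero_iff.2 (hψ.norm_lt_one hjD)
    obtain ⟨t, ht, htj⟩ := hTclos ⟨hT, hball⟩
    have heq : t = j := hψ.2.1.injOn (hTD ht) hjD htj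
    exact Set.disjoint_left.1 hTW ht (heq ▸ hj)

/-! ### Walks through a set of sites -/

/-- The vertices of a walk of `siteGraph S` starting in `S` lie in `S`. [folklore] -/
theorem support_subset_of_walk_siteGraph {S : Set (Site 2)} {v w : Site 2}
    (p : (ChordalLERW.siteGraph S).Walk v w) (hv : v ∈ S) : ∀ y ∈ p.support, y ∈ S := by
  induction p with
  | nil => intro y hy; rw [SimpleGraph.Walk.support_nil, List.mem_singleton] at hy; exact hy ▸ hv
  | cons h p ih =>
      intro y hy
      rw [SimpleGraph.Walk.support_cons, List.mem_cons] at hy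
      rcases hy with rfl | hy
      · exact hv
      · exact ih (ChordalLERW.siteGraph_adj_iff.1 h).2.2 y hy

/-- A point reachable in `siteGraph S` from a point of `S` is joined to it by a lattice walk
through `S`. [folklore] -/
theorem exists_walk_of_reachable {S : Set (Site 2)} {v w : Site 2}
    (h : (ChordalLERW.siteGraph S).Reachable v w) (hv : v ∈ S) :
    ∃ P : (zdGraph 2).Walk v w, ∀ y ∈ P.support, y ∈ S := by
  obtain ⟨p⟩ := h
  refine ⟨p.mapLe (ChordalLERW.siteGraph_le_zdGraph S), fun y hy => ?_⟩
  rw [SimpleGraph.Walk.support_mapLe_eq_support] at hy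
  exact support_subset_of_walk_siteGraph p hv y hy

/-! ### Walks above the screen cannot be killed: the dart tail -/

/-- **A walk through the screened set cannot end at a dart of `D`.** In the setting of
`screening_core`, let `S ⊆ V(D)` avoid the vertices of the screen `W`, and suppose every point of
`D` conformally within the mesh bound `1500/√(log(inrad(D)/3))` of a site of `S` satisfies the
window conditions. Then no lattice walk through `S` from a point `x` with `‖ψ x‖ ≤ m` ends at a
site `u` having a lattice neighbour `b ∉ V(D)`: the exit edge `[u, b)` would be a tail reaching
the circle (the disc map is proper along it). [cite: LawlerSchrammWerner2004, §5.2] -/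
theorem false_of_walk_of_dart (hD : IsClassD D) (hψ : IsDiscMap D ψ) (hR : 8 ≤ infDist (0 : ℂ) Dᶜ)
    {c : ℂ} (hc : ‖c‖ = 1) {a b lo r₀ m : ℝ} (hab : a ≤ b) (hlo : lo ≤ 1) (hr₀ : 0 < r₀)
    {z₁ q' : Site 2} (W : (zdGraph 2).Walk z₁ q') (hWV : ∀ x ∈ W.support, x ∈ latticeVertices D)
    (hΓa : ∃ x ∈ W.support, (ψ (Site.toComplex x) * (starRingEnd ℂ) c).im ≤ a)
    (hΓb : ∃ x ∈ W.support, b ≤ (ψ (Site.toComplex x) * (starRingEnd ℂ) c).im)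
    (hΓwin : ∀ z ∈ range (walkPath W), lo ≤ ‖ψ z‖ ∧ r₀ ≤ (ψ z * (starRingEnd ℂ) c).re ∧
      (a ≤ (ψ z * (starRingEnd ℂ) c).im → (ψ z * (starRingEnd ℂ) c).im ≤ b → m < ‖ψ z‖))
    {S : Set (Site 2)} (hSV : S ⊆ latticeVertices D) (hSW : ∀ y ∈ S, y ∉ W.support)
    (HS : ∀ z ∈ D, (∃ y ∈ S, ‖ψ z - ψ (Site.toComplex y)‖ ≤
        1500 / Real.sqrt (Real.log (infDist (0 : ℂ) Dᶜ / 3))) →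
      a ≤ (ψ z * (starRingEnd ℂ) c).im ∧ (ψ z * (starRingEnd ℂ) c).im ≤ b ∧ lo ≤ ‖ψ z‖ ∧
        r₀ ≤ (ψ z * (starRingEnd ℂ) c).re)
    {x u : Site 2} (P : (zdGraph 2).Walk x u) (hPS : ∀ y ∈ P.support, y ∈ S)
    (hxm : ‖ψ (Site.toComplex x)‖ ≤ m) {b' : Site 2} (hub : (zdGraph 2).Adj u b')
    (hb' : b' ∉ latticeVertices D) : False := by
  have hopen : IsOpen D := hD.1.1
  have hPV : ∀ y ∈ P.support, y ∈ latticeVertices D := fun y hy => hSV (hPS y hy)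
  have hPW : ∀ y ∈ P.support, y ∉ W.support := fun y hy => hSW y (hPS y hy)
  have hu : u ∈ latticeVertices D := hPV u (by simp)
  have huS : u ∈ S := hPS u (by simp)
  have hPD : range (walkPath P) ⊆ D := range_walkPath_subset hD.1 P hPV
  set U := Site.toComplex u with hU
  set B := Site.toComplex b' with hB
  set γ : ℝ → ℂ := fun t => U + (t : ℂ) * (B - U) with hγ
  have hγc : Continuous γ := by rw [hγ]; fun_prop
  set T : Set ℂ := γ '' Ico 0 1 with hT
  have hγD : ∀ t ∈ Ico (0 : ℝ) 1, γ t ∈ D := fun t ht => mem_of_mem_Ico hD.1 hu hub ht.1 ht.2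
  have hTD : T ⊆ D := by rintro _ ⟨t, ht, rfl⟩; exact hγD t ht
  have hTp : IsPreconnected T := isPreconnected_Ico.image γ hγc.continuousOn
  have huT : U ∈ T := ⟨0, ⟨le_rfl, zero_lt_one⟩, by simp [hγ]⟩
  -- window conditions on the polygon and the tail
  have hwin : ∀ z ∈ range (walkPath P) ∪ T, a ≤ (ψ z * (starRingEnd ℂ) c).im ∧
      (ψ z * (starRingEnd ℂ) c).im ≤ b ∧ lo ≤ ‖ψ z‖ ∧ r₀ ≤ (ψ z * (starRingEnd ℂ) c).re := by
    rintro z (hz | ⟨t, ht, rfl⟩)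
    · obtain ⟨y, hy, hyz⟩ := exists_vertex_norm_sub_le hD hψ hR P hPV hz
      exact HS z (hPD hz) ⟨y, hPS y hy, hyz⟩
    · exact HS _ (hγD t ht) ⟨u, huS, norm_sub_le_meshBound_of_dart hD hψ hR hu hub ht.1 ht.2⟩
  -- the norm tends to one along the tail
  have hnorm1 : Tendsto (fun t : ℝ => ‖ψ (γ t)‖) (𝓝[<] (1 : ℝ)) (𝓝 1) := tendsto_norm_dart hD hψ hu hb' hub
  -- `ψ(γ tₙ)` for `tₙ → 1⁻` accumulates at a point of the circle
  have hTtop : ∃ ζ ∈ closure (ψ '' T), ‖ζ‖ = 1 := by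
    set tn : ℕ → ℝ := fun n => 1 - 1 / ((n : ℝ) + 2) with htn
    have htn_mem : ∀ n, tn n ∈ Ico (0 : ℝ) 1 := fun n => by
      have h2 : (2 : ℝ) ≤ (n : ℝ) + 2 := by
        have := Nat.cast_nonneg (α := ℝ) n; linarith
      have h3 : 0 < 1 / ((n : ℝ) + 2) := by positivity
      have h4 : 1 / ((n : ℝ) + 2) ≤ 1 / 2 := by
        rw [div_le_div_iff₀ (by positivity) (by norm_num)]; linarith
      constructor <;> simp only [htn] <;> linarith
    have htn_lim : Tendsto tn atTop (𝓝 1) := by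
      have h : Tendsto (fun n : ℕ => 1 / ((n : ℝ) + 2)) atTop (𝓝 0) := by
        have := tendsto_one_div_add_atTop_nhds_zero_nat (𝕜 := ℝ)
        have h2 : Tendsto (fun n : ℕ => 1 / ((n : ℝ) + 1)) atTop (𝓝 0) := this
        have h3 := h2.comp (tendsto_add_atTop_nat 1)
        refine h3.congr fun n => ?_
        simp only [Function.comp_apply]; push_cast; ring_nf
      have := h.const_sub (1 : ℝ)
      rw [sub_zero] at this
      exact this
    set ζn : ℕ → ℂ := fun n => ψ (γ (tn n)) with hζn
    have hζn_mem : ∀ n, ζn n ∈ closedBall (0 : ℂ) 1 := fun n =>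
      mem_closedBall_zero_iff.2 (hψ.norm_lt_one (hγD _ (htn_mem n))).le
    obtain ⟨ζ, -, φ, hφ, hlim⟩ := (isCompact_closedBall (0 : ℂ) 1).tendsto_subseq hζn_mem
    refine ⟨ζ, ?_, ?_⟩
    · exact mem_closure_of_tendsto hlim (Eventually.of_forall fun n => ⟨_, ⟨tn (φ n), htn_mem _, rfl⟩, rfl⟩)
    · have h1 : Tendsto (fun n => ‖ζn (φ n)‖) atTop (𝓝 ‖ζ‖) := (continuous_norm.tendsto ζ).comp hlim
      have h2 : Tendsto (fun n => ‖ζn (φ n)‖) atTop (𝓝 1) := by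
        have ht : Tendsto (tn ∘ φ) atTop (𝓝[<] (1 : ℝ)) :=
          tendsto_nhdsWithin_iff.2 ⟨htn_lim.comp hφ.tendsto_atTop,
            Eventually.of_forall fun n => (htn_mem (φ n)).2⟩
        exact hnorm1.comp ht
      exact tendsto_nhds_unique h1 h2
  -- points of the closure of `ψ(T)` inside the disc are points of `ψ(T)`
  have hTclos : closure (ψ '' T) ∩ ball 0 1 ⊆ ψ '' T := by
    rintro ζ ⟨hζ, hζ1⟩
    rw [mem_ball_zero_iff] at hζ1
    obtain ⟨sq, hsq, hsqlim⟩ := mem_closure_iff_seq_limit.1 hζ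
    choose z hz hzs using hsq
    choose t ht htz using hz
    obtain ⟨t₀, ht₀, φ, hφ, htlim⟩ := (isCompact_Icc (a := (0 : ℝ)) (b := 1)).tendsto_subseq
      (x := t) fun n => Ico_subset_Icc_self (ht n)
    have hseq : ∀ n, sq (φ n) = ψ (γ (t (φ n))) := fun n => by rw [← hzs, ← htz]
    rcases ht₀.2.lt_or_eq with hlt | heq
    · -- `t₀ < 1`: continuity
      have hcont : ContinuousAt (fun s => ψ (γ s)) t₀ :=
        (hψ.continuousOn.continuousAt (hopen.mem_nhds (hγD t₀ ⟨ht₀.1, hlt⟩))).comp hγc.continuousAt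
      have h1 : Tendsto (fun n => sq (φ n)) atTop (𝓝 (ψ (γ t₀))) := by
        simp only [hseq]; exact hcont.tendsto.comp htlim
      have h2 : Tendsto (fun n => sq (φ n)) atTop (𝓝 ζ) := hsqlim.comp hφ.tendsto_atTop
      rw [tendsto_nhds_unique h2 h1]
      exact ⟨γ t₀, ⟨t₀, ⟨ht₀.1, hlt⟩, rfl⟩, rfl⟩
    · -- `t₀ = 1`: the norms tend to one
      exfalso
      have hwithin : Tendsto (t ∘ φ) atTop (𝓝[<] (1 : ℝ)) :=
        tendsto_nhdsWithin_iff.2 ⟨heq ▸ htlim, Eventually.of_forall fun n => (ht (φ n)).2⟩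
      have h1 : Tendsto (fun n => ‖sq (φ n)‖) atTop (𝓝 1) := by
        simp only [hseq]; exact hnorm1.comp hwithin
      have h2 : Tendsto (fun n => ‖sq (φ n)‖) atTop (𝓝 ‖ζ‖) :=
        ((continuous_norm.tendsto ζ).comp hsqlim).comp hφ.tendsto_atTop
      have := tendsto_nhds_unique h2 h1
      linarith
  -- the tail misses the polygon of the screen
  have hTW : Disjoint T (range (walkPath W)) := by
    rw [Set.disjoint_left]
    rintro _ ⟨t, ht, rfl⟩ hzW
    have hseg : γ t ∈ segment ℝ U B := by
      rw [segment_eq_image']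
      refine ⟨t, ⟨ht.1, ht.2.le⟩, ?_⟩
      simp only [hγ, Complex.real_smul]
    obtain ⟨x₂, hx₂, y₂, hy₂, hxy₂, hz₂⟩ := exists_mem_segment_of_mem_range_walkPath W hzW
    rcases hxy₂ with rfl | hadj₂
    · rw [segment_same, mem_singleton_iff] at hz₂
      rw [hz₂] at hseg
      rcases eq_or_eq_of_toComplex_mem_segment (Or.inr hub) hseg with rfl | rfl
      · exact hSW _ huS hx₂
      · exact hb' (hWV _ hx₂)
    · obtain ⟨z, hz1, hz2⟩ := exists_common_endpoint hub hadj₂ ⟨γ t, hseg, hz₂⟩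
      have hzW' : z ∈ W.support := by rcases hz2 with rfl | rfl <;> assumption
      rcases hz1 with rfl | rfl
      · exact hSW _ huS hzW'
      · exact hb' (hWV _ hzW')
  exact screening_core hD hψ hc hab hlo hr₀ W hWV hΓa hΓb hΓwin P hPV hPW hxm hTD hTp huT hwin hTtop
    hTclos hTW

/-! ### Walks above the screen stay conformally inside: the tail in the direction `c` -/

/-- **Sites reachable through the screened set are conformally no higher than the screen.** In the
setting of `false_of_walk_of_dart`, the endpoint `u` of a lattice walk through `S` from `x`
(`‖ψ x‖ ≤ m`) has `‖ψ u‖ ≤ r_Γ` for every bound `r_Γ` of `‖ψ‖` on the polygon of the screen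
(otherwise the segment from `ψ u` in the direction `c` up to the circle, of constant tangential
coordinate and increasing modulus, would be a tail missing the screen). [cite: LawlerSchrammWerner2004, §5.2] -/
theorem norm_le_of_walk (hD : IsClassD D) (hψ : IsDiscMap D ψ) (hR : 8 ≤ infDist (0 : ℂ) Dᶜ)
    {c : ℂ} (hc : ‖c‖ = 1) {a b lo r₀ m : ℝ} (hab : a ≤ b) (hlo : lo ≤ 1) (hr₀ : 0 < r₀)
    {z₁ q' : Site 2} (W : (zdGraph 2).Walk z₁ q') (hWV : ∀ x ∈ W.support, x ∈ latticeVertices D)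
    (hΓa : ∃ x ∈ W.support, (ψ (Site.toComplex x) * (starRingEnd ℂ) c).im ≤ a)
    (hΓb : ∃ x ∈ W.support, b ≤ (ψ (Site.toComplex x) * (starRingEnd ℂ) c).im)
    (hΓwin : ∀ z ∈ range (walkPath W), lo ≤ ‖ψ z‖ ∧ r₀ ≤ (ψ z * (starRingEnd ℂ) c).re ∧
      (a ≤ (ψ z * (starRingEnd ℂ) c).im → (ψ z * (starRingEnd ℂ) c).im ≤ b → m < ‖ψ z‖))
    {S : Set (Site 2)} (hSV : S ⊆ latticeVertices D) (hSW : ∀ y ∈ S, y ∉ W.support)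
    (HS : ∀ z ∈ D, (∃ y ∈ S, ‖ψ z - ψ (Site.toComplex y)‖ ≤
        1500 / Real.sqrt (Real.log (infDist (0 : ℂ) Dᶜ / 3))) →
      a ≤ (ψ z * (starRingEnd ℂ) c).im ∧ (ψ z * (starRingEnd ℂ) c).im ≤ b ∧ lo ≤ ‖ψ z‖ ∧
        r₀ ≤ (ψ z * (starRingEnd ℂ) c).re)
    {x u : Site 2} (P : (zdGraph 2).Walk x u) (hPS : ∀ y ∈ P.support, y ∈ S)
    (hxm : ‖ψ (Site.toComplex x)‖ ≤ m) {rΓ : ℝ} (hrΓ : ∀ z ∈ range (walkPath W), ‖ψ z‖ ≤ rΓ) :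
    ‖ψ (Site.toComplex u)‖ ≤ rΓ := by
  by_contra hgt
  push Not at hgt
  have hopen : IsOpen D := hD.1.1
  have hPV : ∀ y ∈ P.support, y ∈ latticeVertices D := fun y hy => hSV (hPS y hy)
  have hPW : ∀ y ∈ P.support, y ∉ W.support := fun y hy => hSW y (hPS y hy)
  have hu : u ∈ latticeVertices D := hPV u (by simp)
  have huS : u ∈ S := hPS u (by simp)
  have huD : Site.toComplex u ∈ D := hu
  have hPD : range (walkPath P) ⊆ D := range_walkPath_subset hD.1 P hPV
  set F := Function.invFunOn ψ D with hF
  set ζu : ℂ := ψ (Site.toComplex u) with hζu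
  have hζu1 : ‖ζu‖ < 1 := hψ.norm_lt_one huD
  obtain ⟨hua, hub, hulo, hure⟩ := HS _ huD ⟨u, huS, by rw [sub_self, norm_zero]; positivity⟩
  -- the ray `f t = ζu + t c`
  set f : ℝ → ℂ := fun t => ζu + (t : ℂ) * c with hf
  have hfc : Continuous f := by rw [hf]; fun_prop
  have hcc : c * (starRingEnd ℂ) c = ((‖c‖ ^ 2 : ℝ) : ℂ) := by
    rw [Complex.mul_conj, Complex.normSq_eq_norm_sq]
  have hf_im : ∀ t : ℝ, (f t * (starRingEnd ℂ) c).im = (ζu * (starRingEnd ℂ) c).im := by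
    intro t
    simp only [hf, add_mul, mul_assoc, hcc, Complex.add_im]
    simp [hc]
  have hf_re : ∀ t : ℝ, (f t * (starRingEnd ℂ) c).re = (ζu * (starRingEnd ℂ) c).re + t := by
    intro t
    simp only [hf, add_mul, mul_assoc, hcc, Complex.add_re]
    simp [hc]
  have hf_normsq : ∀ t : ℝ, ‖f t‖ ^ 2 = ‖ζu‖ ^ 2 + 2 * t * (ζu * (starRingEnd ℂ) c).re + t ^ 2 := by
    intro t
    have h1 : ‖f t‖ ^ 2 = ((f t) * (starRingEnd ℂ) (f t)).re := by
      rw [Complex.mul_conj, Complex.normSq_eq_norm_sq]; norm_cast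
    rw [h1]
    simp only [hf, map_add, map_mul, Complex.conj_ofReal, add_mul, mul_add, Complex.add_re]
    have e1 : (ζu * (starRingEnd ℂ) ζu).re = ‖ζu‖ ^ 2 := by
      rw [Complex.mul_conj, Complex.normSq_eq_norm_sq]; norm_cast
    have e2 : ((t : ℂ) * c * ((t : ℂ) * (starRingEnd ℂ) c)).re = t ^ 2 := by
      have : (t : ℂ) * c * ((t : ℂ) * (starRingEnd ℂ) c) = ((t ^ 2 : ℝ) : ℂ) * (c * (starRingEnd ℂ) c) := by
        push_cast; ring
      rw [this, hcc, ← Complex.ofReal_mul, Complex.ofReal_re, hc]; ring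
    have e3 : (ζu * ((t : ℂ) * (starRingEnd ℂ) c)).re = t * (ζu * (starRingEnd ℂ) c).re := by
      have : ζu * ((t : ℂ) * (starRingEnd ℂ) c) = (t : ℂ) * (ζu * (starRingEnd ℂ) c) := by ring
      rw [this, Complex.re_ofReal_mul]
    have e4 : ((t : ℂ) * c * (starRingEnd ℂ) ζu).re = t * (ζu * (starRingEnd ℂ) c).re := by
      have : ((t : ℂ) * c * (starRingEnd ℂ) ζu) = (starRingEnd ℂ) ((t : ℂ) * (ζu * (starRingEnd ℂ) c)) := by
        simp [map_mul, Complex.conj_ofReal]; ring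
      rw [this, Complex.conj_re, Complex.re_ofReal_mul]
    rw [e1, e2, e3, e4]; ring
  have hf_norm_ge : ∀ t : ℝ, 0 ≤ t → ‖ζu‖ ≤ ‖f t‖ := by
    intro t ht
    have h := hf_normsq t
    have hpos : 0 ≤ 2 * t * (ζu * (starRingEnd ℂ) c).re + t ^ 2 := by
      have := hr₀.le.trans hure
      positivity
    nlinarith [norm_nonneg (f t), norm_nonneg ζu]
  -- the first time the ray reaches the circle
  set A : Set ℝ := {t | 0 ≤ t ∧ 1 ≤ ‖f t‖} with hA
  have hAclosed : IsClosed A :=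
    (isClosed_le continuous_const continuous_id).inter (isClosed_le continuous_const (continuous_norm.comp hfc))
  have h2A : (2 : ℝ) ∈ A := by
    refine ⟨by norm_num, ?_⟩
    have h := hf_normsq 2
    have hre := hr₀.le.trans hure
    nlinarith [norm_nonneg (f 2), norm_nonneg ζu]
  have hAne : A.Nonempty := ⟨2, h2A⟩
  have hAbdd : BddBelow A := ⟨0, fun t ht => ht.1⟩
  set tstar : ℝ := sInf A with htstar
  have htA : tstar ∈ A := hAclosed.csInf_mem hAne hAbdd
  have h0A : (0 : ℝ) ∉ A := fun h => by
    have := h.2; simp only [hf, Complex.ofReal_zero, zero_mul, add_zero] at this; linarith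
  have htpos : 0 < tstar := lt_of_le_of_ne htA.1 fun h => h0A (h ▸ htA)
  have hlt_of_lt : ∀ t, 0 ≤ t → t < tstar → ‖f t‖ < 1 := by
    intro t ht0 ht
    by_contra hge; push Not at hge
    exact notMem_of_lt_csInf ht hAbdd ⟨ht0, hge⟩
  have hfstar : ‖f tstar‖ = 1 := by
    refine le_antisymm ?_ htA.2
    -- limit from the left of values `< 1`
    have hcont : ContinuousAt (fun t => ‖f t‖) tstar := (continuous_norm.comp hfc).continuousAt
    have hlim : Tendsto (fun t => ‖f t‖) (𝓝[<] tstar) (𝓝 ‖f tstar‖) := hcont.tendsto.mono_left nhdsWithin_le_nhds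
    refine le_of_tendsto hlim ?_
    filter_upwards [Ioo_mem_nhdsLT htpos] with t ht using (hlt_of_lt t ht.1.le ht.2).le
  -- the tail `T = ψ⁻¹(f [0, t*))`
  set T' : Set ℂ := f '' Ico 0 tstar with hT'
  have hT'ball : T' ⊆ ball 0 1 := by
    rintro _ ⟨t, ht, rfl⟩; exact mem_ball_zero_iff.2 (hlt_of_lt t ht.1 ht.2)
  set T : Set ℂ := F '' T' with hT
  have hTD : T ⊆ D := by rintro _ ⟨w, hw, rfl⟩; exact hψ.mapsTo_inv (hT'ball hw)
  have hψT : ∀ w ∈ T', ψ (F w) = w := fun w hw => hψ.rightInvOn (hT'ball hw)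
  have hFc : ContinuousOn F (ball 0 1) := (hψ.differentiableOn_inv hopen).continuousOn
  have hTp : IsPreconnected T :=
    (isPreconnected_Ico.image f hfc.continuousOn).image F (hFc.mono hT'ball)
  have hf0 : f 0 = ζu := by simp [hf]
  have huT : Site.toComplex u ∈ T := by
    refine ⟨ζu, ⟨0, ⟨le_rfl, htpos⟩, hf0⟩, ?_⟩
    exact hψ.leftInvOn huD
  have hψTimg : ψ '' T = T' := by
    apply Subset.antisymm
    · rintro _ ⟨_, ⟨w, hw, rfl⟩, rfl⟩; rw [hψT w hw]; exact hw
    · intro w hw; exact ⟨F w, ⟨w, hw, rfl⟩, hψT w hw⟩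
  -- window conditions
  have hwin : ∀ z ∈ range (walkPath P) ∪ T, a ≤ (ψ z * (starRingEnd ℂ) c).im ∧
      (ψ z * (starRingEnd ℂ) c).im ≤ b ∧ lo ≤ ‖ψ z‖ ∧ r₀ ≤ (ψ z * (starRingEnd ℂ) c).re := by
    rintro z (hz | ⟨_, ⟨t, ht, rfl⟩, rfl⟩)
    · obtain ⟨y, hy, hyz⟩ := exists_vertex_norm_sub_le hD hψ hR P hPV hz
      exact HS z (hPD hz) ⟨y, hPS y hy, hyz⟩
    · rw [hψT _ ⟨t, ht, rfl⟩, hf_im, hf_re]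
      exact ⟨hua, hub, hulo.trans (hf_norm_ge t ht.1), hure.trans (by linarith [ht.1])⟩
  -- the closure of `ψ(T) = f [0, t*)` reaches the circle at `f t*`
  have hTtop : ∃ ζ ∈ closure (ψ '' T), ‖ζ‖ = 1 := by
    refine ⟨f tstar, ?_, hfstar⟩
    rw [hψTimg]
    have hlim : Tendsto f (𝓝[<] tstar) (𝓝 (f tstar)) := hfc.continuousAt.tendsto.mono_left nhdsWithin_le_nhds
    refine mem_closure_of_tendsto hlim ?_
    filter_upwards [Ioo_mem_nhdsLT htpos] with t ht using ⟨t, ⟨ht.1.le, ht.2⟩, rfl⟩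
  have hTclos : closure (ψ '' T) ∩ ball 0 1 ⊆ ψ '' T := by
    rw [hψTimg]
    rintro ζ ⟨hζ, hζ1⟩
    have hsub : closure T' ⊆ f '' Icc 0 tstar :=
      closure_minimal (image_mono Ico_subset_Icc_self) ((isCompact_Icc.image hfc).isClosed)
    obtain ⟨t, ht, rfl⟩ := hsub hζ
    rcases ht.2.lt_or_eq with hlt | heq
    · exact ⟨t, ⟨ht.1, hlt⟩, rfl⟩
    · exfalso
      rw [mem_ball_zero_iff, heq, hfstar] at hζ1
      exact lt_irrefl _ hζ1
  have hTW : Disjoint T (range (walkPath W)) := by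
    rw [Set.disjoint_left]
    rintro _ ⟨w, ⟨t, ht, rfl⟩, rfl⟩ hzW
    have h1 := hrΓ _ hzW
    rw [hψT _ ⟨t, ht, rfl⟩] at h1
    have h2 := hf_norm_ge t ht.1
    linarith
  exact screening_core hD hψ hc hab hlo hr₀ W hWV hΓa hΓb hΓwin P hPV hPW hxm hTD hTp huT hwin hTtop
    hTclos hTW

/-! ### The screened component -/

/-- **The component of `x` in the screened set of sites.** In the setting of
`false_of_walk_of_dart`, let `x ∈ S` with `‖ψ x‖ ≤ m` and let `U` be the set of sites reachable
from `x` in `siteGraph S`. Then `U ⊆ S`, `U` is finite, every lattice neighbour of a site of `U`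
lies in `V(D)` (the walk cannot be killed from `U`), and a lattice neighbour of a site of `U` that
is not in `U` is not in `S`. [cite: LawlerSchrammWerner2004, §5.2] -/
theorem screened_component (hD : IsClassD D) (hψ : IsDiscMap D ψ) (hR : 8 ≤ infDist (0 : ℂ) Dᶜ)
    {c : ℂ} (hc : ‖c‖ = 1) {a b lo r₀ m : ℝ} (hab : a ≤ b) (hlo : lo ≤ 1) (hr₀ : 0 < r₀)
    {z₁ q' : Site 2} (W : (zdGraph 2).Walk z₁ q') (hWV : ∀ x ∈ W.support, x ∈ latticeVertices D)
    (hΓa : ∃ x ∈ W.support, (ψ (Site.toComplex x) * (starRingEnd ℂ) c).im ≤ a)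
    (hΓb : ∃ x ∈ W.support, b ≤ (ψ (Site.toComplex x) * (starRingEnd ℂ) c).im)
    (hΓwin : ∀ z ∈ range (walkPath W), lo ≤ ‖ψ z‖ ∧ r₀ ≤ (ψ z * (starRingEnd ℂ) c).re ∧
      (a ≤ (ψ z * (starRingEnd ℂ) c).im → (ψ z * (starRingEnd ℂ) c).im ≤ b → m < ‖ψ z‖))
    {S : Set (Site 2)} (hSV : S ⊆ latticeVertices D) (hSW : ∀ y ∈ S, y ∉ W.support)
    (HS : ∀ z ∈ D, (∃ y ∈ S, ‖ψ z - ψ (Site.toComplex y)‖ ≤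
        1500 / Real.sqrt (Real.log (infDist (0 : ℂ) Dᶜ / 3))) →
      a ≤ (ψ z * (starRingEnd ℂ) c).im ∧ (ψ z * (starRingEnd ℂ) c).im ≤ b ∧ lo ≤ ‖ψ z‖ ∧
        r₀ ≤ (ψ z * (starRingEnd ℂ) c).re)
    {x : Site 2} (hxS : x ∈ S) (hxm : ‖ψ (Site.toComplex x)‖ ≤ m) :
    {u | (ChordalLERW.siteGraph S).Reachable x u} ⊆ S ∧
    {u | (ChordalLERW.siteGraph S).Reachable x u}.Finite ∧
    (∀ u ∈ {u | (ChordalLERW.siteGraph S).Reachable x u}, ∀ e : SRW.Dir 2,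
      u + SRW.stepVec e ∈ latticeVertices D) ∧
    (∀ u ∈ {u | (ChordalLERW.siteGraph S).Reachable x u}, ∀ e : SRW.Dir 2,
      u + SRW.stepVec e ∉ {u | (ChordalLERW.siteGraph S).Reachable x u} → u + SRW.stepVec e ∉ S) := by
  have hUS : ∀ u, (ChordalLERW.siteGraph S).Reachable x u → u ∈ S := by
    intro u hu
    by_cases hux : x = u
    · exact hux ▸ hxS
    · exact support_siteGraph_subset S
        (SimpleGraph.mem_support_of_reachable (fun h => hux h.symm) (SimpleGraph.Reachable.symm hu))
  refine ⟨fun u hu => hUS u hu, ?_, ?_, ?_⟩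
  · -- finiteness: all of `U` has `‖ψ‖ ≤ r_Γ = max over the polygon of the screen < 1`
    have hWD : range (walkPath W) ⊆ D := range_walkPath_subset hD.1 W hWV
    have hcont : ContinuousOn (fun z => ‖ψ z‖) (range (walkPath W)) :=
      continuous_norm.comp_continuousOn (hψ.continuousOn.mono hWD)
    obtain ⟨z₀, hz₀, hmax⟩ := (isCompact_range (walkPath W).continuous).exists_isMaxOn
      (range_nonempty _) hcont
    have hr1 : ‖ψ z₀‖ < 1 := hψ.norm_lt_one (hWD hz₀)
    refine (finite_latticeVertices_norm_le hD hψ hr1).subset fun u hu => ?_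
    obtain ⟨P, hPS⟩ := exists_walk_of_reachable hu hxS
    exact ⟨hSV (hUS u hu), norm_le_of_walk hD hψ hR hc hab hlo hr₀ W hWV hΓa hΓb hΓwin hSV hSW HS P
      hPS hxm fun z hz => hmax hz⟩
  · -- no killing from `U`
    intro u hu e
    by_contra hnot
    obtain ⟨P, hPS⟩ := exists_walk_of_reachable hu hxS
    exact false_of_walk_of_dart hD hψ hR hc hab hlo hr₀ W hWV hΓa hΓb hΓwin hSV hSW HS P hPS hxm
      (zdGraph_adj_add_stepVec u e) hnot
  · -- a neighbour outside `U` is outside `S`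
    intro u hu e hne heS
    refine hne (SimpleGraph.Reachable.trans hu (SimpleGraph.Adj.reachable ?_))
    exact ChordalLERW.siteGraph_adj_iff.2 ⟨zdGraph_adj_add_stepVec u e, hUS u hu, heS⟩

end LSWGrid

end Literature.Probability.LatticeModels

end
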